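import Summits.ValiantsHypothesis.ValiantsHypothesis.Theorems.DivisionGapPerDivisionHardStubSubexpRigid
import Summits.ValiantsHypothesis.ValiantsHypothesis.Theorems.DivisionGapPerDivisionHardStubAtomicTop

/-!
# Crux `DivisionGap.PerDivisionHard` (stmt-ValiantsHypothesis-5065), line `pair-descent-jss-endpoint` —
stub `stub_atomicRigid`: K2 for ATOMIC EXPRESSIONS, by counting placements

An atomic expression is `h = Σ_{l ∈ L} a_l · x^{C_l} · ∏_{β ∈ I} F_β^{μ_l(β)}` over `ℝ≥0[x_ij]`.
`stub_atomicRigid`: for all `d` there are `e n₀` such that for `n ≥ n₀` every nonzero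
torus-homogeneous atomic expression with nonzero torus-homogeneous atoms, at most
`2^{n/(log₂ n+e)^e}` terms, `Σ_β |supp F_β|² ≤ 2^{n/(log₂ n+e)^e}` and pairwise atomic distance
`∏_{β : μ_l(β) ≠ μ_{l'}(β)} |supp F_β| ≤ 2^{n/(log₂ n+e)^e}` admits a placement `eR eC` of the block
arsenal `G(b,k) ⊕ M₀` with `b ≥ (log₂ n + d)^d`, a weight `w` cutting out the placed face, and a
single `G`-part `u` of its top-`w` fibre (which is in fact a single monomial).

This is `stub_subexpRigid` (`Theorems/DivisionGapPerDivisionHardStubSubexpRigid.lean`) with a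
richer bad family.  Parameters: `L = log₂ n`, `q = (L + d + 1)^{d+1}`, `b = q`, `k = n / (4q²)`,
`N = q + q²k` corner rows, `t₀ = 4k + 2`, `e = 2d + 4` (so `x := n / (L + e)^e ≤ k`),
`n ≥ 16q³`.
1. BAD FAMILY of row sets: (i) internal pairs — the rows where two monomials `f, f'` of one atom
   `F_β` differ (at most `Σ_β |supp F_β|² ≤ 2^x` sets); (ii) cross vectors — for an ordered pair
   of distinct terms `l ≠ l'` and a pattern `σ ∈ ∏_{β : μ_l β ≠ μ_{l'} β} supp F_β`
   (`Finset.pi`), the rows of the integer matrix `C_l - C_{l'} + Σ_β (μ_l β - μ_{l'} β) · σ_β`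
   (at most `|L|² · 2^x ≤ 2^{3x}` sets).  In total `≤ 2^{3x+1} ≤ 2^{t₀}` sets, so by
   `exists_goodSubset` / `count_lt` some `N`-set `R` of rows contains no bad set of size `≥ t₀`;
   label the rows so that the core and internal labels land in `R` (`exists_blockEquiv`).
2. The generic weight `w` (radix `B = deg h + 1`) cuts out the placed graph `G`
   (`cutsOut_genericWeight` via `exists_blockMatching`).  EXCLUSION: an integer matrix supported
   on `G` with vanishing margins whose row set is in the bad family vanishes — otherwise it
   occupies `≥ 4k + 2` rows (`placedFlow_card_rows`), all of them in `R`
   (`placedFlow_row_notPadding`).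
3. Atoms: two monomials of `top_w F_β` with entries `< B` have equal weight and equal degree
   (`F_β` torus-homogeneous), hence agree off `G` (`weight_add_offDigitSum`,
   `eq_offG_of_offDigitSum_eq`); their difference is a circulation in `G` with row set in (i), so
   they coincide.
4. Fibre: `m₁, m₂ ∈ supp (top_w h)` decompose by `stub_atomicTop` as
   `m_i = C_{l_i} + Σ_β Σ_{j<μ_{l_i} β} f^{(i)}_{β,j}` with all `f^{(i)}_{β,j} ∈ supp (top_w F_β)`
   and entries `≤ deg h < B`; by step 3 all of them equal one `b_β`, so
   `m_i = C_{l_i} + Σ_β μ_{l_i} β · b_β`.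
   If `l₁ = l₂` then `m₁ = m₂`; otherwise `m₁ - m₂` agrees off `G`
   (`eq_offG_of_mem_support_topComponent`), has vanishing margins (`sum_diff_eq_zero`) and is the
   cross vector of the pattern `b` — row set in (ii) — so it vanishes.  Hence the top fibre is a
   single monomial `m₀`, and `u = m₀|_G`.
-/

noncomputable section

-- `Summit.ValiantsHypothesis.ValiantsHypothesis.…` is the tree's mandated single-conjunct layout
-- (Sub = Summit), so the duplicated namespace component is intended.
set_option linter.dupNamespace false

namespace Summit.ValiantsHypothesis.ValiantsHypothesis.Theorems.DivisionGapPerDivisionHard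

open MvPolynomial Literature.Computability.AlgebraicComplexity
open Summit.ValiantsHypothesis.ValiantsHypothesis.Theorems.ZeroOneTransfer.Negative
open scoped NNReal

/-- **`stub_atomicRigid` (K2 of line `pair-descent-jss-endpoint` for ATOMIC EXPRESSIONS).**  For
every `d` there are `e, n₀` such that for `n ≥ n₀`: a nonzero torus-homogeneous atomic expression
`Σ_{l ∈ L} a_l · x^{C_l} · ∏_{β ∈ I} F_β^{μ_l(β)}` with nonzero torus-homogeneous atoms, at most
`2^{n/(log₂ n+e)^e}` terms, `Σ_β |supp F_β|² ≤ 2^{n/(log₂ n+e)^e}`, and pairwise atomic distance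
`∏_{β : μ_l(β) ≠ μ_{l'}(β)} |supp F_β| ≤ 2^{n/(log₂ n+e)^e}`, admits a placement of `G(b,k) ⊕ M₀`
(`b = (log₂ n + d + 1)^{d+1} ≥ (log₂ n + d)^d`, `k = n/(4b²)`), a weight cutting out the placed
face, and a single `G`-part of its top fibre.  Placement by counting (`exists_goodSubset`,
`count_lt`) against the row sets of (i) differences of two monomials of one atom and (ii) cross
vectors `C_l - C_{l'} + Σ_β (μ_l β - μ_{l'} β) • σ_β`, `σ ∈ Finset.pi` of the supports of the atoms
where `μ_l ≠ μ_{l'}`; generic weight; fibre monomials decompose by `stub_atomicTop`, every atom's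
top fibre is one monomial, and two fibre monomials differ by a cross vector — both excluded by the
girth substitute `placedFlow_card_rows` / `placedFlow_row_notPadding`. [folklore] -/
theorem stub_atomicRigid :
    ∀ d : ℕ, ∃ e n₀ : ℕ, ∀ n ≥ n₀, ∀ (ι κ : Type) (I : Finset ι) (L : Finset κ)
      (F : ι → MvPolynomial (Fin n × Fin n) ℝ≥0) (a : κ → ℝ≥0) (C : κ → (Fin n × Fin n) →₀ ℕ)
      (μ : κ → ι → ℕ),
      (∀ β ∈ I, F β ≠ 0) → (∀ β ∈ I, IsTorusHomogeneous (F β)) →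
      (∑ l ∈ L, a l • (monomial (C l) (1 : ℝ≥0) * ∏ β ∈ I, F β ^ μ l β)) ≠ 0 →
      IsTorusHomogeneous (∑ l ∈ L, a l • (monomial (C l) (1 : ℝ≥0) * ∏ β ∈ I, F β ^ μ l β)) →
      L.card ≤ 2 ^ (n / (Nat.log 2 n + e) ^ e) →
      (∑ β ∈ I, (F β).support.card ^ 2) ≤ 2 ^ (n / (Nat.log 2 n + e) ^ e) →
      (∀ l ∈ L, ∀ l' ∈ L, l ≠ l' →
        ∏ β ∈ I.filter (fun β => μ l β ≠ μ l' β), (F β).support.card ≤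
          2 ^ (n / (Nat.log 2 n + e) ^ e)) →
      ∃ (b k m : ℕ) (eR eC : BlockV b k m ≃ Fin n) (w : Fin n × Fin n → ℕ)
        (u : (Fin n × Fin n) →₀ ℕ),
        (Nat.log 2 n + d) ^ d ≤ b ∧ CutsOut w (placedBlock eR eC) ∧
          HasSingleGPart (placedBlock eR eC) w
            (∑ l ∈ L, a l • (monomial (C l) (1 : ℝ≥0) * ∏ β ∈ I, F β ^ μ l β)) u := by
  intro d
  obtain ⟨L₀, hL₀⟩ := growth d
  refine ⟨2 * d + 4, 2 ^ (L₀ + 1),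
    fun n hn ι κ I L F a C μ _hF0 hFtor hh htor hLcard hIcard hdist => ?_⟩
  classical
  set h := ∑ l ∈ L, a l • (monomial (C l) (1 : ℝ≥0) * ∏ β ∈ I, F β ^ μ l β) with hhdef
  -- the parameters (verbatim from `stub_subexpRigid`)
  have hn0 : n ≠ 0 := by
    have : 1 ≤ 2 ^ (L₀ + 1) := Nat.one_le_two_pow
    omega
  have hLL₀ : L₀ + 1 ≤ Nat.log 2 n := Nat.le_log_of_pow_le one_lt_two hn
  have h2L : 2 ^ Nat.log 2 n ≤ n := Nat.pow_log_le_self 2 hn0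
  have hq16 := hL₀ (Nat.log 2 n) (by omega)
  have he := four_mul_sq_le_pow (Nat.log 2 n) d
  set lg := Nat.log 2 n with hlg
  have hy : 2 ≤ lg + d + 1 := by omega
  have hdq : (lg + d) ^ d ≤ (lg + d + 1) ^ (d + 1) :=
    (Nat.pow_le_pow_left (by omega) d).trans (Nat.pow_le_pow_right (by omega) (by omega))
  have hq2 : 2 ≤ (lg + d + 1) ^ (d + 1) :=
    (Nat.le_self_pow (Nat.succ_ne_zero _) 2).trans (Nat.pow_le_pow_left hy _)
  set q := (lg + d + 1) ^ (d + 1) with hq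
  have hQ : 4 * q ≤ q * (q * q) := Nat.mul_comm 4 q ▸ Nat.mul_le_mul_left q (Nat.mul_le_mul hq2 hq2)
  have hqq : 4 ≤ q * q := Nat.mul_le_mul hq2 hq2
  have hq0 : 0 < q := by omega
  have hqqq : q * q ≤ q * (q * q) := Nat.mul_le_mul_left q (Nat.le_mul_of_pos_left q hq0)
  -- the subdivision length `k = n / (4q²)`
  have h4qq : 0 < 4 * (q * q) := by omega
  have hk : 0 < n / (4 * (q * q)) := Nat.div_pos (by omega) h4qq
  have hX : 4 * (q * (q * (n / (4 * (q * q))))) ≤ n :=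
    calc 4 * (q * (q * (n / (4 * (q * q))))) = n / (4 * (q * q)) * (4 * (q * q)) := by ring
      _ ≤ n := Nat.div_mul_le_self n (4 * (q * q))
  have hke : n / (lg + (2 * d + 4)) ^ (2 * d + 4) ≤ n / (4 * (q * q)) :=
    Nat.div_le_div_left he h4qq
  set k := n / (4 * (q * q)) with hkdef
  set x := n / (lg + (2 * d + 4)) ^ (2 * d + 4) with hxdef
  have h4k : 4 * k ≤ q * (q * k) := by
    rw [← Nat.mul_assoc]
    exact Nat.mul_le_mul_right k hqq
  -- the bad family of row sets: (i) internal pairs of an atom, (ii) cross vectors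
  let rowsZ : (Fin n × Fin n → ℤ) → Finset (Fin n) := fun D =>
    Finset.univ.filter fun r => ∃ c, D (r, c) ≠ 0
  let V : (p : κ × κ) →
      ((β : ι) → β ∈ I.filter (fun β => μ p.1 β ≠ μ p.2 β) → ((Fin n × Fin n) →₀ ℕ)) →
        (Fin n × Fin n → ℤ) := fun p τ e =>
    (C p.1 e : ℤ) - C p.2 e +
      ∑ β ∈ (I.filter fun β => μ p.1 β ≠ μ p.2 β).attach, ((μ p.1 β : ℤ) - μ p.2 β) * τ β β.2 e
  let P₁ : Finset (Finset (Fin n)) := I.biUnion fun β =>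
    ((F β).support ×ˢ (F β).support).image fun p => rowsZ fun e => (p.1 e : ℤ) - p.2 e
  let P₂ : Finset (Finset (Fin n)) := ((L ×ˢ L).filter fun p => p.1 ≠ p.2).biUnion fun p =>
    ((I.filter fun β => μ p.1 β ≠ μ p.2 β).pi fun β => (F β).support).image fun τ => rowsZ (V p τ)
  set P := (P₁ ∪ P₂).filter fun t => 4 * k + 2 ≤ t.card with hP
  have hP₁ : P₁.card ≤ 2 ^ x :=
    calc P₁.card ≤ ∑ β ∈ I, (((F β).support ×ˢ (F β).support).image fun p =>
          rowsZ fun e => (p.1 e : ℤ) - p.2 e).card := Finset.card_biUnion_le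
      _ ≤ ∑ β ∈ I, (F β).support.card ^ 2 := Finset.sum_le_sum fun β _ =>
          Finset.card_image_le.trans (by rw [Finset.card_product, sq])
      _ ≤ 2 ^ x := hIcard
  have hP₂ : P₂.card ≤ 2 ^ x * 2 ^ x * 2 ^ x :=
    calc P₂.card ≤ ∑ p ∈ (L ×ˢ L).filter (fun p => p.1 ≠ p.2),
          (((I.filter fun β => μ p.1 β ≠ μ p.2 β).pi fun β => (F β).support).image fun τ =>
            rowsZ (V p τ)).card := Finset.card_biUnion_le
      _ ≤ ∑ p ∈ (L ×ˢ L).filter (fun p => p.1 ≠ p.2), 2 ^ x := Finset.sum_le_sum fun p hp => by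
          obtain ⟨hp, hne⟩ := Finset.mem_filter.mp hp
          obtain ⟨h1, h2⟩ := Finset.mem_product.mp hp
          refine Finset.card_image_le.trans ?_
          rw [Finset.card_pi]
          exact hdist _ h1 _ h2 hne
      _ = ((L ×ˢ L).filter fun p => p.1 ≠ p.2).card * 2 ^ x := by rw [Finset.sum_const, smul_eq_mul]
      _ ≤ L.card * L.card * 2 ^ x :=
          Nat.mul_le_mul_right _ ((Finset.card_filter_le _ _).trans (Finset.card_product _ _).le)
      _ ≤ 2 ^ x * 2 ^ x * 2 ^ x := Nat.mul_le_mul_right _ (Nat.mul_le_mul hLcard hLcard)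
  have hPcard : P.card ≤ 2 ^ (4 * k + 2) :=
    calc P.card ≤ (P₁ ∪ P₂).card := Finset.card_filter_le _ _
      _ ≤ P₁.card + P₂.card := Finset.card_union_le _ _
      _ ≤ 2 ^ x + 2 ^ x * 2 ^ x * 2 ^ x := Nat.add_le_add hP₁ hP₂
      _ ≤ 2 ^ (3 * x) + 2 ^ (3 * x) := by
          rw [← pow_add, ← pow_add]
          exact Nat.add_le_add (Nat.pow_le_pow_right two_pos (by omega))
            (Nat.pow_le_pow_right two_pos (by omega))
      _ = 2 ^ (3 * x + 1) := by rw [pow_succ, mul_two]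
      _ ≤ 2 ^ (4 * k + 2) := Nat.pow_le_pow_right two_pos (by omega)
  -- a good set of `N = q + q²k` corner rows and the placement
  obtain ⟨R, hRcard, hRgood⟩ := exists_goodSubset P (fun t => t) (q + q * (q * k)) (4 * k + 2)
    (fun p hp => (Finset.mem_filter.mp hp).2)
    (by rw [Fintype.card_fin]; exact count_lt (by omega) (by omega) hPcard (by omega))
  obtain ⟨eR, heR₁, heR₂⟩ :=
    exists_blockEquiv R q k (n - (q + q * (q * k))) hRcard (by rw [hRcard])
  set G := placedBlock eR eR with hG
  set B := h.totalDegree + 1 with hB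
  have hB0 : 0 < B := Nat.succ_pos _
  -- the generic weight cuts out `G`
  obtain ⟨g, hg⟩ := exists_blockMatching q k (n - (q + q * (q * k))) hk
  obtain ⟨σ₀, hσ₀⟩ := exists_perm_mem_placedBlock eR eR g hg
  have hcut : CutsOut (genericWeight G B) G := cutsOut_genericWeight G hB0 σ₀ hσ₀
  -- exclusion: an integer matrix supported on `G` with vanishing margins whose row set belongs
  -- to the bad family vanishes (else it occupies `≥ 4k + 2` rows, all of them in `R`)
  have hexcl : ∀ D : Fin n × Fin n → ℤ, (∀ e, D e ≠ 0 → e ∈ G) → (∀ r, ∑ c, D (r, c) = 0) →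
      (∀ c, ∑ r, D (r, c) = 0) → rowsZ D ∈ P₁ ∪ P₂ → ∀ e, D e = 0 := by
    intro D hDG hrow hcol hmem
    by_contra hne
    push Not at hne
    have hrows := placedFlow_card_rows eR eR hk hDG hrow hcol hne
    refine hRgood (rowsZ D) (Finset.mem_filter.mpr ⟨hmem, hrows⟩) fun r hr => ?_
    obtain ⟨c', hc'⟩ := (Finset.mem_filter.mp hr).2
    have hpad := placedFlow_row_notPadding eR eR hDG hrow hcol hc'
    obtain ⟨y, rfl⟩ := eR.surjective r
    rcases y with i | p | u
    · exact heR₁ i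
    · exact heR₂ p
    · exact absurd (eR.symm_apply_apply _) (hpad u)
  have hlt : ∀ m ∈ h.support, ∀ e, m e < B := fun m hm e =>
    Nat.lt_succ_of_le ((Finsupp.le_degree e m).trans (le_totalDegree hm))
  -- (i) every atom's top fibre is a single monomial among those with entries `< B`
  have hatom : ∀ β ∈ I, ∀ f ∈ (topComponent (genericWeight G B) (F β)).support,
      ∀ f' ∈ (topComponent (genericWeight G B) (F β)).support,
      (∀ e, f e < B) → (∀ e, f' e < B) → f = f' := by
    intro β hβ f hf f' hf' hfB hf'B
    have hs := support_topComponent_subset _ _ hf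
    have hs' := support_topComponent_subset _ _ hf'
    obtain ⟨r₀, c₀, hrc⟩ := hFtor β hβ
    have hdeg : f.degree = f'.degree :=
      degree_eq_of_rowDegrees_eq ((hrc f hs).1.trans (hrc f' hs').1.symm)
    have hw := weight_eq_of_mem_support_topComponent _ _ hf
    have hw' := weight_eq_of_mem_support_topComponent _ _ hf'
    have e₁ := weight_add_offDigitSum G hB0 f
    have e₂ := weight_add_offDigitSum G hB0 f'
    rw [hdeg] at e₁
    have hoff : ∀ e ∉ G, f e = f' e := eq_offG_of_offDigitSum_eq G hfB hf'B (by omega)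
    obtain ⟨hrow, hcol⟩ := sum_diff_eq_zero ((hrc f hs).1.trans (hrc f' hs').1.symm)
      ((hrc f hs).2.trans (hrc f' hs').2.symm)
    have hDG : ∀ e, (fun e => (f e : ℤ) - f' e) e ≠ 0 → e ∈ G := fun e he => by
      by_contra heG
      exact he (by simp only [hoff e heG, sub_self])
    have hmem : rowsZ (fun e => (f e : ℤ) - f' e) ∈ P₁ ∪ P₂ :=
      Finset.mem_union_left _ (Finset.mem_biUnion.mpr
        ⟨β, hβ, Finset.mem_image_of_mem _ (Finset.mk_mem_product hs hs')⟩)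
    have h0 := hexcl _ hDG hrow hcol hmem
    exact Finsupp.ext fun e => by exact_mod_cast sub_eq_zero.mp (h0 e)
  -- (ii) the top fibre of `h` is a single monomial
  have hfib : ∀ m₁ ∈ (topComponent (genericWeight G B) h).support,
      ∀ m₂ ∈ (topComponent (genericWeight G B) h).support, m₁ = m₂ := by
    intro m₁ hm₁ m₂ hm₂
    have hs₁ := support_topComponent_subset _ h hm₁
    have hs₂ := support_topComponent_subset _ h hm₂
    obtain ⟨r₀, c₀, hrc⟩ := htor
    have hoff := eq_offG_of_mem_support_topComponent G hm₁ hm₂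
      (degree_eq_of_rowDegrees_eq ((hrc m₁ hs₁).1.trans (hrc m₂ hs₂).1.symm))
    obtain ⟨hrow, hcol⟩ := sum_diff_eq_zero ((hrc m₁ hs₁).1.trans (hrc m₂ hs₂).1.symm)
      ((hrc m₁ hs₁).2.trans (hrc m₂ hs₂).2.symm)
    have hDG : ∀ e, (fun e => (m₁ e : ℤ) - m₂ e) e ≠ 0 → e ∈ G := fun e he => by
      by_contra heG
      exact he (by simp only [hoff e heG, sub_self])
    -- decompose both monomials atom by atom
    obtain ⟨l₁, hl₁, f₁, hf₁, hm₁eq⟩ :=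
      stub_atomicTop n ι κ I L F a C μ (genericWeight G B) m₁ hm₁
    obtain ⟨l₂, hl₂, f₂, hf₂, hm₂eq⟩ :=
      stub_atomicTop n ι κ I L F a C μ (genericWeight G B) m₂ hm₂
    have hle₁ : ∀ β ∈ I, ∀ j < μ l₁ β, f₁ β j ≤ m₁ := fun β hβ j hj => by
      rw [hm₁eq]
      calc f₁ β j ≤ ∑ j' ∈ Finset.range (μ l₁ β), f₁ β j' :=
            Finset.single_le_sum (fun _ _ => zero_le) (Finset.mem_range.mpr hj)
        _ ≤ ∑ β' ∈ I, ∑ j' ∈ Finset.range (μ l₁ β'), f₁ β' j' :=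
            Finset.single_le_sum (f := fun β' => ∑ j' ∈ Finset.range (μ l₁ β'), f₁ β' j')
              (fun _ _ => zero_le) hβ
        _ ≤ _ := le_add_self
    have hle₂ : ∀ β ∈ I, ∀ j < μ l₂ β, f₂ β j ≤ m₂ := fun β hβ j hj => by
      rw [hm₂eq]
      calc f₂ β j ≤ ∑ j' ∈ Finset.range (μ l₂ β), f₂ β j' :=
            Finset.single_le_sum (fun _ _ => zero_le) (Finset.mem_range.mpr hj)
        _ ≤ ∑ β' ∈ I, ∑ j' ∈ Finset.range (μ l₂ β'), f₂ β' j' :=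
            Finset.single_le_sum (f := fun β' => ∑ j' ∈ Finset.range (μ l₂ β'), f₂ β' j')
              (fun _ _ => zero_le) hβ
        _ ≤ _ := le_add_self
    have hf₁B : ∀ β ∈ I, ∀ j < μ l₁ β, ∀ e, f₁ β j e < B := fun β hβ j hj e =>
      lt_of_le_of_lt (Finsupp.le_def.mp (hle₁ β hβ j hj) e) (hlt m₁ hs₁ e)
    have hf₂B : ∀ β ∈ I, ∀ j < μ l₂ β, ∀ e, f₂ β j e < B := fun β hβ j hj e =>
      lt_of_le_of_lt (Finsupp.le_def.mp (hle₂ β hβ j hj) e) (hlt m₂ hs₂ e)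
    -- the common top monomial `bb β` of the atom `F β`
    let bb : ι → (Fin n × Fin n) →₀ ℕ := fun β => if 0 < μ l₁ β then f₁ β 0 else f₂ β 0
    have hb₁ : ∀ β ∈ I, ∀ j ∈ Finset.range (μ l₁ β), f₁ β j = bb β := by
      intro β hβ j hj
      have hj' := Finset.mem_range.mp hj
      have hpos : 0 < μ l₁ β := by omega
      simp only [bb, if_pos hpos]
      exact hatom β hβ _ (hf₁ β hβ j hj') _ (hf₁ β hβ 0 hpos) (hf₁B β hβ j hj')
        (hf₁B β hβ 0 hpos)
    have hb₂ : ∀ β ∈ I, ∀ j ∈ Finset.range (μ l₂ β), f₂ β j = bb β := by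
      intro β hβ j hj
      have hj' := Finset.mem_range.mp hj
      by_cases hpos : 0 < μ l₁ β
      · simp only [bb, if_pos hpos]
        exact hatom β hβ _ (hf₂ β hβ j hj') _ (hf₁ β hβ 0 hpos) (hf₂B β hβ j hj')
          (hf₁B β hβ 0 hpos)
      · simp only [bb, if_neg hpos]
        exact hatom β hβ _ (hf₂ β hβ j hj') _ (hf₂ β hβ 0 (by omega)) (hf₂B β hβ j hj')
          (hf₂B β hβ 0 (by omega))
    have hm₁' : m₁ = C l₁ + ∑ β ∈ I, μ l₁ β • bb β := by
      rw [hm₁eq]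
      congr 1
      refine Finset.sum_congr rfl fun β hβ => ?_
      rw [Finset.sum_congr rfl (hb₁ β hβ), Finset.sum_const, Finset.card_range]
    have hm₂' : m₂ = C l₂ + ∑ β ∈ I, μ l₂ β • bb β := by
      rw [hm₂eq]
      congr 1
      refine Finset.sum_congr rfl fun β hβ => ?_
      rw [Finset.sum_congr rfl (hb₂ β hβ), Finset.sum_const, Finset.card_range]
    by_cases hl : l₁ = l₂
    · subst hl
      exact hm₁'.trans hm₂'.symm
    -- `l₁ ≠ l₂`: the difference is the cross vector of the pattern `bb`
    let τ : (β : ι) → β ∈ I.filter (fun β => μ l₁ β ≠ μ l₂ β) → ((Fin n × Fin n) →₀ ℕ) :=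
      fun β _ => bb β
    have hτ : τ ∈ (I.filter fun β => μ l₁ β ≠ μ l₂ β).pi fun β => (F β).support := by
      refine Finset.mem_pi.mpr fun β hβ => ?_
      obtain ⟨hβI, hne⟩ := Finset.mem_filter.mp hβ
      by_cases hpos : 0 < μ l₁ β
      · simp only [τ, bb, if_pos hpos]
        exact support_topComponent_subset _ _ (hf₁ β hβI 0 hpos)
      · simp only [τ, bb, if_neg hpos]
        exact support_topComponent_subset _ _ (hf₂ β hβI 0 (by omega))
    have hsum : ∀ e, ∑ β ∈ (I.filter fun β => μ l₁ β ≠ μ l₂ β).attach,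
        ((μ l₁ β : ℤ) - μ l₂ β) * τ β β.2 e =
          ∑ β ∈ I, ((μ l₁ β : ℤ) - μ l₂ β) * bb β e := by
      intro e
      have h1 : ∑ β ∈ (I.filter fun β => μ l₁ β ≠ μ l₂ β).attach,
          ((μ l₁ β : ℤ) - μ l₂ β) * τ β β.2 e =
            ∑ β ∈ (I.filter fun β => μ l₁ β ≠ μ l₂ β), ((μ l₁ β : ℤ) - μ l₂ β) * bb β e :=
        Finset.sum_attach _ (fun β => ((μ l₁ β : ℤ) - μ l₂ β) * bb β e)
      rw [h1]
      exact Finset.sum_filter_of_ne fun β _ hne heq => hne (by rw [heq, sub_self, zero_mul])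
    have hDV : (fun e => (m₁ e : ℤ) - m₂ e) = V (l₁, l₂) τ := by
      funext e
      simp only [V]
      rw [hsum e, hm₁', hm₂']
      simp only [Finsupp.coe_add, Pi.add_apply, Finsupp.coe_finsetSum, Finset.sum_apply,
        Finsupp.coe_smul, Pi.smul_apply, smul_eq_mul, sub_mul, Finset.sum_sub_distrib]
      push_cast
      ring
    have hmem : rowsZ (fun e => (m₁ e : ℤ) - m₂ e) ∈ P₁ ∪ P₂ := by
      rw [hDV]
      exact Finset.mem_union_right _ (Finset.mem_biUnion.mpr ⟨(l₁, l₂),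
        Finset.mem_filter.mpr ⟨Finset.mk_mem_product hl₁ hl₂, hl⟩, Finset.mem_image_of_mem _ hτ⟩)
    have h0 := hexcl _ hDG hrow hcol hmem
    exact Finsupp.ext fun e => by exact_mod_cast sub_eq_zero.mp (h0 e)
  -- conclusion: `u` is the `G`-part of the unique monomial of the top fibre
  obtain ⟨m₀, hm₀⟩ := support_nonempty.mpr (topComponent_ne_zero (genericWeight G B) hh)
  refine ⟨q, k, n - (q + q * (q * k)), eR, eR, genericWeight G B, m₀.filter (· ∈ G), hdq, hcut,
    fun e he => ?_, fun m' hm' e he => ?_⟩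
  · rw [Finsupp.support_filter] at he
    exact (Finset.mem_filter.mp he).2
  · rw [hfib m' hm' m₀ hm₀, Finsupp.filter_apply_pos _ _ he]

end Summit.ValiantsHypothesis.ValiantsHypothesis.Theorems.DivisionGapPerDivisionHard

end
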